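/-
Copyright (c) 2026 the pub-hodgecm-mathlib formalisation cell (harness21).  Prover seat hodgecm-mathlib-K2E3-p28 (g3) (U1 desk, LEAD F0P6-plan (g15) BATCH #192 (2); free hand),
Track B «K2-LIT» ∕ hLiu418 = stmt-HodgeConjecture-24832: organ U1-CT-ind stage 3 («U1-glob») LEVEL 2 — (F-split) THE FACES SPLIT OF THE KERNEL-PLACE HEAD `HT`: from ★ (F-tail)'s
`hpure`∕`hHT`, ★ (E10a) everywhere-adapted datum, ★ (E6′) away purity, ★ (E9) local integrability and ★ p862082 Fubini to ★ (F-rest)'s by-value letters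
`(K₀ hK₀ hIw G hSieg hsm hflat hsplit)`, modulo ONE by-value arch letter (integrability of the arch flat block).  THEOREMS ONLY.
-/
import Summits.HodgeConjecture.HodgeConjecture.Theorems.K2LiuStdDatumFinsetAdapted             -- ★ (E10a) `exists_isStd_adaptedEverywhere`
import Summits.HodgeConjecture.HodgeConjecture.Theorems.K2LiuBigCellLocalFace                  -- ★ (E10) `hIw_local`, `heightTwistLoc_flat` (+ ★ (E6′) `exists_awayPurity_flat`, `heightTwistLoc_siegel∕_smooth`)
import Summits.HodgeConjecture.HodgeConjecture.Theorems.K2LiuLocalSiegelSectionIntegrable       -- ★ (E9) `integrable_weylDelta_mul_unipDeltaLoc_cm`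
import Summits.HodgeConjecture.HodgeConjecture.Theorems.K2LiuBigCellTBlockFubini               -- ★ p862082 `integral_eq_sum_of_pureTensor`
import Summits.HodgeConjecture.HodgeConjecture.Theorems.K2LiuStdExtensionPureAt                -- ★ B2b FILE 3 (this seat): `mul_prod_eq_apply_mul`
import Summits.HodgeConjecture.HodgeConjecture.Theorems.K2LiuSiegelUnipotentCharacters          -- ★ `continuous_unipDeltaChar`
import Summits.HodgeConjecture.HodgeConjecture.Theorems.K2LiuSiegelUnipotentSplitAtDefs         -- `unipDeltaLoc`, `unipDeltaArch`
import HarnessLib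

/-!
# Crux `HLiu418`, U1-glob LEVEL 2 — (F-split) `K2LiuLocalKernelHeadSplitAtKernelPlace`: THE FACES SPLIT OF THE `∞ × (T∖v₀)` HEAD AT THE KERNEL PLACE
# `HT(s,h′) = Σ_{i<m} A_i(s) · ∏_{v∈T∖v₀} ∫_{N_Δ(L⁺_v)} conj ψ_S(ι_v y) · G_{i,v,s}((w_Δ)_v y h′_v) dν_v(y)` on `{1 < re s}`   [KudlaRallis1994 §2; Tan1999 §3; HKS1996 §6]

Cell `hodgecm-mathlib`, crux item hLiu418 = `stmt-HodgeConjecture-24832`; squad K2, strike line L1; U1-glob END pen K2E3-p32 (g3) (FILE B `K2LiuLocalKernelResidueVanishes`, the consumer);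
prover + U1 desk K2E3-p28 (g3).  Lane `--supports stmt-HodgeConjecture-24832 --as helper` (count-neutral).  THEOREMS ONLY (no `def`, no `instance`, no notation, no named-fact
hypothesis, no `sorry`).  The CM doubled datum at rank `n = 2` (frame `e : Fin N × Fin M ≃ Fin 2`, ★ (E9)'s currency); general index `S`, base parameter `s₀`, point `h′`.

THE POINT (END pen K2E3-p32 (g3) census 00:54:39Z (5) Q1; desk 01:00Z).  ★ (F-rest) `K2LiuLocalKernelClearedRestAtKernelPlace.exists_clearedRest_kernelPlace` takes the FACES
SPLIT `hsplit` of the head `HT` — and the local letters `(K₀ hK₀ hIw G hSieg hsm hflat)` of its finite faces — BY VALUE, while ★ (F-tail) `exists_kernelPlace_tailPackage` exports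
`HT` only as ★ FILE 2's `∞ × (T∖v₀)` integral of the opaque rest `rT` (`hHT`) with the purity clause `hpure : f_s ∘ placesEmbed_T = bT ⊗ rT`.  This file derives the split:
(1) ★ (E10a) `exists_isStd_adaptedEverywhere`: a standard `𝒦⁺ ⊇ 𝒦` STILL CARRYING `f` with a compact open Iwasawa `K₀ v`, `ι_v(K₀ v) ⊆ 𝒦⁺.K`, at every place; (2) ★ (E6′)
`exists_awayPurity_flat` at `𝒦⁺`: off a finite `S₀`, `f_s ∘ placesEmbed_T = Σ_{i<m} (H_∞^{2(s−s₀)}A_i) ⊗ ⊗_{v∈T} (H_v^{2(s−s₀)} b_{i,v})` with the five letters; (3) dividing by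
`bT s u₀ = t^{2(s−s₀)}·d ≠ 0` (the kernel-place factor at a point `u₀` with `b u₀ ≠ 0`): `rT_s` is the finite sum of pure tensors `Σ_i c_i(s)·(H_∞^{…}A_i) ⊗ ⊗_{w∈T∖v₀}(H_w^{…}b_{i,w})`
with ENTIRE coefficients `c_i`; (4) ★ p862082 `integral_eq_sum_of_pureTensor` on `ν_∞ ⊗ ⊗_{w≠v₀} ν_w` with the integrability letters ★ (E9) `integrable_weylDelta_mul_unipDeltaLoc_cm`
(finite faces, `1 < re s`) and the ARCHIMEDEAN one BY VALUE (`hAint`, the (β)-END `hArch` shape ∀-closed over standard data, at an arbitrary arch translate); (5) the local letters of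
`G_{i,v} = H_v^{2(s−s₀)} b_{i,v}` by ★ `heightTwistLoc_siegel ∕ _smooth ∕ _flat`, the local Iwasawa letter by ★ `hIw_local`, and the re-indexing `{w : T ∕∕ w ≠ v₀} ↔ T.erase v₀`.
EXPORTED with the split: the arch faces READ as `A_i(s) = c_i(s) · ∫ conj ψ_S(ι_∞ p) · H_∞((w_Δ)_∞ p h′_∞)^{2(s−s₀)} A_i((w_Δ)_∞ p h′_∞) dν_∞(p)` with `c_i` entire and `A_i`'s three (E6′)
arch letters at `𝒦⁺` — so FILE B pays ★ (F-rest)'s `(A Ac hA hAc)` from ONE by-value arch continuation letter.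
References: [KudlaRallis1994] S. Kudla, S. Rallis, Ann. of Math. 140 (1994), §1–§2; [Tan1999] V. Tan, §1 p. 166, §3; [HarrisKudlaSweet1996] §1 (1.15)–(1.17), §6 (6.14)–(6.16);
[KudlaSweet1997] §1; [BorelJacquet1979] §4.1; [Casselman1980] §3 Thm. 3.1; [Shimura1997] §18.4.
HONEST LABEL.  Count-neutral helper: `HC_CM` is proved only modulo the 7 printed citations (2 remaining named inputs: hLiu418 = `stmt-HodgeConjecture-24832`, h413 =
`stmt-HodgeConjecture-24833`) until rung 0 closes; LEVEL 2 stays OPEN (FILE B; the arch letters by value).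
-/

set_option autoImplicit false
set_option linter.dupNamespace false -- the mandated namespace repeats `HodgeConjecture.HodgeConjecture`

noncomputable section

open scoped Matrix RestrictedProduct ENNReal NNReal Topology ComplexConjugate
open NumberField IsDedekindDomain MeasureTheory Measure Filter Set

namespace Summit.HodgeConjecture.HodgeConjecture.Cruxes.HLiu418.K2LiuLocalKernelHeadSplitAtKernelPlace

open Literature.NumberTheory.Automorphic Literature.NumberTheory.GaloisRepresentations
open Literature.NumberTheory.GelbartRogawski1991 Literature.NumberTheory.GelbartRogawski1991.GRConstruction
open Literature.NumberTheory.GelbartRogawski1991.UnitaryDualPair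
open Literature.NumberTheory.K2Lit.SiegelDoubled Literature.NumberTheory.K2Lit.LocalSiegelDoubled
open Literature.NumberTheory.K2Lit.PlaceSplitting
open Summit.HodgeConjecture.HodgeConjecture.Cruxes.HLiu418.K2LiuSiegelUnipotentLocalDefs
open Summit.HodgeConjecture.HodgeConjecture.Cruxes.HLiu418.K2LiuSiegelUnipotentSplitDefs
open Summit.HodgeConjecture.HodgeConjecture.Cruxes.HLiu418.K2LiuSiegelUnipotentSplitAtDefs
open Summit.HodgeConjecture.HodgeConjecture.Cruxes.HLiu418.K2LiuSiegelUnipotentFourierDefs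
open Summit.HodgeConjecture.HodgeConjecture.Cruxes.HLiu418.K2LiuSiegelUnipotentCharacters (continuous_unipDeltaChar)
open Summit.HodgeConjecture.HodgeConjecture.Cruxes.HLiu418.K2LiuStdDatumFinsetAdapted (exists_isStd_adaptedEverywhere)
open Summit.HodgeConjecture.HodgeConjecture.Cruxes.HLiu418.K2LiuStdFamilyAwayPurityFlat (exists_awayPurity_flat heightTwistLoc_siegel heightTwistLoc_smooth differentiable_heightTwist)
open Summit.HodgeConjecture.HodgeConjecture.Cruxes.HLiu418.K2LiuBigCellLocalFace (hIw_local heightTwistLoc_flat)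
open Summit.HodgeConjecture.HodgeConjecture.Cruxes.HLiu418.K2LiuLocalSiegelSectionIntegrable (integrable_weylDelta_mul_unipDeltaLoc_cm)
open Summit.HodgeConjecture.HodgeConjecture.Cruxes.HLiu418.K2LiuBigCellTBlockFubini (integral_eq_sum_of_pureTensor)
open Summit.HodgeConjecture.HodgeConjecture.Cruxes.HLiu418.K2LiuStdExtensionPureAt (mul_prod_eq_apply_mul)

variable (L : Type) [Field L] [NumberField L] [IsCMField L]
variable {N M : ℕ} (e : Fin N × Fin M ≃ Fin 2)
  (dV : Fin N → L) (hdV : ∀ i, IsCMField.complexConj L (dV i) = dV i)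
  (dW : Fin M → L) (hdW : ∀ i, IsCMField.complexConj L (dW i) = dW i)
  [DecidableEq (HeightOneSpectrum (𝓞 (Fp L)))]
  [MeasurableSpace ↥(unipDeltaArch L e dV hdV dW hdW)] [BorelSpace ↥(unipDeltaArch L e dV hdV dW hdW)]
  [∀ v : HeightOneSpectrum (𝓞 (Fp L)), MeasurableSpace ↥(unipDeltaLoc L e dV hdV dW hdW v)] [∀ v : HeightOneSpectrum (𝓞 (Fp L)), BorelSpace ↥(unipDeltaLoc L e dV hdV dW hdW v)]

/-! ## §0 Re-indexing the finite faces -/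

/-- re-indexing a product over `{w : T ∕∕ w ≠ v₀}` as a product over `T.erase v₀`. [folklore] -/
theorem prod_subtype_ne_eq_prod_erase {R : Type*} [CommMonoid R] {α : Type*} [DecidableEq α] (T : Finset α) {a : α} (ha : a ∈ T)
    (f : {w : T // w ≠ ⟨a, ha⟩} → R) (g : α → R) (hfg : ∀ w, f w = g w.1.1) :
    ∏ w, f w = ∏ v ∈ T.erase a, g v := by
  rw [← Finset.prod_coe_sort (T.erase a)]
  refine Fintype.prod_equiv
    { toFun := fun w => ⟨w.1.1, Finset.mem_erase.2 ⟨fun h => w.2 (Subtype.ext h), w.1.2⟩⟩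
      invFun := fun v => ⟨⟨v.1, Finset.mem_of_mem_erase v.2⟩, fun h => (Finset.mem_erase.1 v.2).1 (congrArg Subtype.val h)⟩
      left_inv := fun w => rfl
      right_inv := fun v => rfl } _ _ (fun w => ?_)
  exact hfg w

/-! ## §1 The faces split -/

set_option maxHeartbeats 2400000 in -- MEASURED: statement `whnf` fails at 800 000; the ★ p862082 Fubini step's `isDefEq` fails at 1 600 000; passes at 2 400 000 (★ (F-tail) p863777's class)
/-- **(F-split) THE FACES SPLIT OF THE KERNEL-PLACE HEAD.**  `𝒦` standard, `f := stdExtension 𝒦 s₀ φ` `𝒦`-standard with continuous members, `χ_v` unitary at every place,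
and the ARCH INTEGRABILITY LETTER `hAint` by value.  THEN off a finite `S₀`: for every `T ⊇ S₀` with `v₀ ∈ T`, every kernel-place factor `bT` with `bT s u₀ = t^{2(s−s₀)}·d`
(`t > 0`, `d ≠ 0`), every rest `rT` with ★ (F-tail)'s purity clause `hpure`, all Haar carriers `ν_∞, ν_v`, every index `S`, point `h′` and head `HT` with ★ (F-tail)'s `hHT`:
`∃ m A K₀ G` — the arch faces `A i` READ through entire `c i` and (E6′) arch data at a standard `𝒦⁺ ⊇ 𝒦`, compact open Iwasawa `K₀ v` on `T.erase v₀`, local families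
`G i v s ∈ I_v(s, χ_v)` smooth and `K₀ v`-flat — with `HT s h′ = Σ_i A i s · ∏_{v ∈ T.erase v₀} ∫ conj ψ_S(ι_v y)·G i v s ((w_Δ)_v·y·h′_v) dν_v(y)` on `{1 < re s}`
(★ (F-rest)'s `hsplit` at `I := univ`, `Tw := T.erase v₀`, `hpt v := h′_v`). [cite: KudlaRallis1994, §1–§2] [cite: Tan1999, §1 p. 166; §3] [cite: HarrisKudlaSweet1996, §1 (1.15)–(1.17); §6 (6.14)–(6.16)]
[cite: KudlaSweet1997, §1] [cite: BorelJacquet1979, §4.1] [cite: Casselman1980, §3 Thm. 3.1] -/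
theorem exists_headSplit_kernelPlace (hdV0 : ∀ i, dV i ≠ 0) (hdW0 : ∀ i, dW i ≠ 0)
    {𝒦 : IwasawaDatum L e dV hdV dW hdW} (h𝒦 : 𝒦.IsStd) {χ : HeckeCharacter L}
    (hχ1 : ∀ (v : HeightOneSpectrum (𝓞 (Fp L))) (w' : UnitaryGroup.PlacesOver L v) (x : (w'.1.adicCompletion L)ˣ), ‖((χ.localComponent w'.1 x : ℂˣ) : ℂ)‖ = 1)
    (s₀ : ℂ) {φ : HA L e dV hdV dW hdW → ℂ}
    (hstd : IsStandardSectionFamily 𝒦 χ (stdExtension 𝒦 s₀ φ)) (hcont : ∀ s, Continuous (stdExtension 𝒦 s₀ φ s))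
    (v₀ : HeightOneSpectrum (𝓞 (Fp L)))
    -- THE ARCHIMEDEAN INTEGRABILITY LETTER, by value ((β)-END `hArch` shape, ∀-closed over standard data and (E6′) arch data, at an arbitrary arch translate `x`)
    (hAint : ∀ (𝒦'' : IwasawaDatum L e dV hdV dW hdW), 𝒦''.IsStd →
      ∀ (A : UnitaryGroup.arch (Fp L) L (IsCMField.complexConj L) (2 + 2) (hermD L e dV hdV dW hdW) → ℂ),
        (∀ p : HA L e dV hdV dW hdW, GRConstruction.IsSiegelDelta L e dV hdV dW hdW p → UnitaryGroup.finPart (Fp L) L (IsCMField.complexConj L) (2 + 2) (hermD L e dV hdV dW hdW) p = 1 →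
          ∀ x : UnitaryGroup.arch (Fp L) L (IsCMField.complexConj L) (2 + 2) (hermD L e dV hdV dW hdW), A (UnitaryGroup.archPart (Fp L) L (IsCMField.complexConj L) (2 + 2) (hermD L e dV hdV dW hdW) p * x) = siegelDeltaCharacter L e dV hdV dW hdW χ s₀ p * A x) →
        (∃ V : Submodule ℂ (UnitaryGroup.arch (Fp L) L (IsCMField.complexConj L) (2 + 2) (hermD L e dV hdV dW hdW) → ℂ), FiniteDimensional ℂ V ∧ A ∈ V ∧
          ∀ a₀ : UnitaryGroup.arch (Fp L) L (IsCMField.complexConj L) (2 + 2) (hermD L e dV hdV dW hdW), (UnitaryGroup.archToAdelic (Fp L) L (IsCMField.complexConj L) (2 + 2) (hermD L e dV hdV dW hdW) a₀ : HA L e dV hdV dW hdW) ∈ 𝒦''.K → ∀ G ∈ V, (fun x => G (x * a₀)) ∈ V) →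
        Continuous A →
        ∀ (νinf : Measure ↥(unipDeltaArch L e dV hdV dW hdW)) [νinf.IsHaarMeasure] [SigmaFinite νinf] (x : UnitaryGroup.arch (Fp L) L (IsCMField.complexConj L) (2 + 2) (hermD L e dV hdV dW hdW)) (s : ℂ), 1 < s.re →
          Integrable (fun p : ↥(unipDeltaArch L e dV hdV dW hdW) =>
            ((modDelta L e dV hdV dW hdW (𝒦''.pPart (UnitaryGroup.archToAdelic (Fp L) L (IsCMField.complexConj L) (2 + 2) (hermD L e dV hdV dW hdW) (UnitaryGroup.archPart (Fp L) L (IsCMField.complexConj L) (2 + 2) (hermD L e dV hdV dW hdW) (weylDelta L e dV hdV dW hdW) * (p : UnitaryGroup.arch (Fp L) L (IsCMField.complexConj L) (2 + 2) (hermD L e dV hdV dW hdW)) * x))) : ℝ) : ℂ) ^ (2 * (s - s₀)) *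
              A (UnitaryGroup.archPart (Fp L) L (IsCMField.complexConj L) (2 + 2) (hermD L e dV hdV dW hdW) (weylDelta L e dV hdV dW hdW) * (p : UnitaryGroup.arch (Fp L) L (IsCMField.complexConj L) (2 + 2) (hermD L e dV hdV dW hdW)) * x)) νinf) :
    ∃ S₀ : Finset (HeightOneSpectrum (𝓞 (Fp L))), ∀ (T : Finset (HeightOneSpectrum (𝓞 (Fp L)))), S₀ ⊆ T → ∀ (hv₀ : v₀ ∈ T)
      (bT : ℂ → UnitaryGroup.localPi L (IsCMField.complexConj L) (2 + 2) (hermD L e dV hdV dW hdW) v₀ → ℂ) (u₀ : UnitaryGroup.localPi L (IsCMField.complexConj L) (2 + 2) (hermD L e dV hdV dW hdW) v₀) (t : ℝ) (_ht : 0 < t) (d : ℂ) (_hd : d ≠ 0)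
      (_hbT : ∀ s : ℂ, bT s u₀ = ((t : ℝ) : ℂ) ^ (2 * (s - s₀)) * d)
      (rT : ℂ → UnitaryGroup.arch (Fp L) L (IsCMField.complexConj L) (2 + 2) (hermD L e dV hdV dW hdW) × (Π w : {w : T // w ≠ ⟨v₀, hv₀⟩}, UnitaryGroup.localPi L (IsCMField.complexConj L) (2 + 2) (hermD L e dV hdV dW hdW) w.1.1) → ℂ)
      (_hpure : ∀ (s : ℂ) (yi : UnitaryGroup.arch (Fp L) L (IsCMField.complexConj L) (2 + 2) (hermD L e dV hdV dW hdW)) (y : Π v : T, UnitaryGroup.localPi L (IsCMField.complexConj L) (2 + 2) (hermD L e dV hdV dW hdW) v.1),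
        stdExtension 𝒦 s₀ φ s (placesEmbed L (hermD L e dV hdV dW hdW) T (yi, y)) = bT s (y ⟨v₀, hv₀⟩) * rT s (yi, fun w : {w : T // w ≠ ⟨v₀, hv₀⟩} => y w.1))
      (νinf : Measure ↥(unipDeltaArch L e dV hdV dW hdW)) [νinf.IsHaarMeasure] [SigmaFinite νinf]
      (νv : ∀ v : HeightOneSpectrum (𝓞 (Fp L)), Measure ↥(unipDeltaLoc L e dV hdV dW hdW v)) [∀ v, (νv v).IsHaarMeasure] [∀ v, SigmaFinite (νv v)]
      (S : Matrix (Fin 2) (Fin 2) L) (h' : HA L e dV hdV dW hdW) (HT : ℂ → HA L e dV hdV dW hdW → ℂ)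
      (_hHT : ∀ (s : ℂ) (h'' : HA L e dV hdV dW hdW), HT s h'' =
        ∫ p, (conj (unipDeltaChar L e dV hdV dW hdW S (UnitaryGroup.archToAdelic (Fp L) L (IsCMField.complexConj L) (2 + 2) (hermD L e dV hdV dW hdW) (p.1 : UnitaryGroup.arch (Fp L) L (IsCMField.complexConj L) (2 + 2) (hermD L e dV hdV dW hdW))) : ℂ) *
              ∏ w : {w : T // w ≠ ⟨v₀, hv₀⟩}, conj (unipDeltaChar L e dV hdV dW hdW S
                (locToAdelic L e dV hdV dW hdW w.1.1 ((p.2 w : ↥(unipDeltaLoc L e dV hdV dW hdW w.1.1)) : UnitaryGroup.localPi L (IsCMField.complexConj L) (2 + 2) (hermD L e dV hdV dW hdW) w.1.1)) : ℂ)) *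
            rT s (UnitaryGroup.archPart (Fp L) L (IsCMField.complexConj L) (2 + 2) (hermD L e dV hdV dW hdW) (weylDelta L e dV hdV dW hdW) * (p.1 : UnitaryGroup.arch (Fp L) L (IsCMField.complexConj L) (2 + 2) (hermD L e dV hdV dW hdW)) * UnitaryGroup.archPart (Fp L) L (IsCMField.complexConj L) (2 + 2) (hermD L e dV hdV dW hdW) h'',
                fun w : {w : T // w ≠ ⟨v₀, hv₀⟩} => UnitaryGroup.evalPlace (Fp L) L (IsCMField.complexConj L) (2 + 2) (hermD L e dV hdV dW hdW) w.1.1 (UnitaryGroup.finPart (Fp L) L (IsCMField.complexConj L) (2 + 2) (hermD L e dV hdV dW hdW) (weylDelta L e dV hdV dW hdW)) *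
                  ((p.2 w : ↥(unipDeltaLoc L e dV hdV dW hdW w.1.1)) : UnitaryGroup.localPi L (IsCMField.complexConj L) (2 + 2) (hermD L e dV hdV dW hdW) w.1.1) * UnitaryGroup.evalPlace (Fp L) L (IsCMField.complexConj L) (2 + 2) (hermD L e dV hdV dW hdW) w.1.1 (UnitaryGroup.finPart (Fp L) L (IsCMField.complexConj L) (2 + 2) (hermD L e dV hdV dW hdW) h''))
          ∂(νinf.prod (Measure.pi fun w : {w : T // w ≠ ⟨v₀, hv₀⟩} => νv w.1.1))),
      ∃ (m : ℕ) (Aface : Fin m → ℂ → ℂ) (K₀ : ∀ v : HeightOneSpectrum (𝓞 (Fp L)), Subgroup (UnitaryGroup.localPi L (IsCMField.complexConj L) (2 + 2) (hermD L e dV hdV dW hdW) v))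
        (G : Fin m → ∀ v : HeightOneSpectrum (𝓞 (Fp L)), ℂ → UnitaryGroup.localPi L (IsCMField.complexConj L) (2 + 2) (hermD L e dV hdV dW hdW) v → ℂ),
        -- the arch faces READ (for the by-value arch continuation letter)
        (∃ (𝒦'' : IwasawaDatum L e dV hdV dW hdW) (c : Fin m → ℂ → ℂ) (A : Fin m → UnitaryGroup.arch (Fp L) L (IsCMField.complexConj L) (2 + 2) (hermD L e dV hdV dW hdW) → ℂ), 𝒦''.IsStd ∧ 𝒦.K ≤ 𝒦''.K ∧
          (∀ i, Differentiable ℂ (c i)) ∧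
          (∀ i, ∀ p : HA L e dV hdV dW hdW, GRConstruction.IsSiegelDelta L e dV hdV dW hdW p → UnitaryGroup.finPart (Fp L) L (IsCMField.complexConj L) (2 + 2) (hermD L e dV hdV dW hdW) p = 1 →
            ∀ x : UnitaryGroup.arch (Fp L) L (IsCMField.complexConj L) (2 + 2) (hermD L e dV hdV dW hdW), A i (UnitaryGroup.archPart (Fp L) L (IsCMField.complexConj L) (2 + 2) (hermD L e dV hdV dW hdW) p * x) = siegelDeltaCharacter L e dV hdV dW hdW χ s₀ p * A i x) ∧
          (∀ i, ∃ V : Submodule ℂ (UnitaryGroup.arch (Fp L) L (IsCMField.complexConj L) (2 + 2) (hermD L e dV hdV dW hdW) → ℂ), FiniteDimensional ℂ V ∧ A i ∈ V ∧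
            ∀ a₀ : UnitaryGroup.arch (Fp L) L (IsCMField.complexConj L) (2 + 2) (hermD L e dV hdV dW hdW), (UnitaryGroup.archToAdelic (Fp L) L (IsCMField.complexConj L) (2 + 2) (hermD L e dV hdV dW hdW) a₀ : HA L e dV hdV dW hdW) ∈ 𝒦''.K → ∀ G ∈ V, (fun x => G (x * a₀)) ∈ V) ∧
          (∀ i, Continuous (A i)) ∧
          ∀ (i : Fin m) (s : ℂ), Aface i s = c i s * ∫ p : ↥(unipDeltaArch L e dV hdV dW hdW), (conj (unipDeltaChar L e dV hdV dW hdW S (UnitaryGroup.archToAdelic (Fp L) L (IsCMField.complexConj L) (2 + 2) (hermD L e dV hdV dW hdW) (p : UnitaryGroup.arch (Fp L) L (IsCMField.complexConj L) (2 + 2) (hermD L e dV hdV dW hdW))) : ℂ) *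
              (((modDelta L e dV hdV dW hdW (𝒦''.pPart (UnitaryGroup.archToAdelic (Fp L) L (IsCMField.complexConj L) (2 + 2) (hermD L e dV hdV dW hdW) (UnitaryGroup.archPart (Fp L) L (IsCMField.complexConj L) (2 + 2) (hermD L e dV hdV dW hdW) (weylDelta L e dV hdV dW hdW) * (p : UnitaryGroup.arch (Fp L) L (IsCMField.complexConj L) (2 + 2) (hermD L e dV hdV dW hdW)) * UnitaryGroup.archPart (Fp L) L (IsCMField.complexConj L) (2 + 2) (hermD L e dV hdV dW hdW) h'))) : ℝ) : ℂ) ^ (2 * (s - s₀)) *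
                A i (UnitaryGroup.archPart (Fp L) L (IsCMField.complexConj L) (2 + 2) (hermD L e dV hdV dW hdW) (weylDelta L e dV hdV dW hdW) * (p : UnitaryGroup.arch (Fp L) L (IsCMField.complexConj L) (2 + 2) (hermD L e dV hdV dW hdW)) * UnitaryGroup.archPart (Fp L) L (IsCMField.complexConj L) (2 + 2) (hermD L e dV hdV dW hdW) h'))) ∂νinf) ∧
        (∀ v ∈ T.erase v₀, IsCompact (K₀ v : Set (UnitaryGroup.localPi L (IsCMField.complexConj L) (2 + 2) (hermD L e dV hdV dW hdW) v)) ∧ IsOpen (K₀ v : Set (UnitaryGroup.localPi L (IsCMField.complexConj L) (2 + 2) (hermD L e dV hdV dW hdW) v))) ∧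
        (haveI : Algebra.IsQuadraticExtension (Fp L) L := IsCMField.isQuadraticExtension L
          ∀ v ∈ T.erase v₀, ∀ g : UnitaryGroup.localPi L (IsCMField.complexConj L) (2 + 2) (hermD L e dV hdV dW hdW) v,
            ∃ p, LocalSplitting.IsSiegelDelta (Fp L) L (IsCMField.complexConj L) (complexConj_imagUnit L) (imagUnit_ne_zero L) (imagUnit_mul_self L)
              v 2 (gramR_isSymm L e dV hdV dW hdW) (hermD_eq_map_gramD L e dV hdV dW hdW) p ∧ ∃ k ∈ K₀ v, g = p * k) ∧
        (haveI : Algebra.IsQuadraticExtension (Fp L) L := IsCMField.isQuadraticExtension L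
          ∀ i, ∀ v ∈ T.erase v₀, ∀ s, IsLocalSiegelSection (Fp L) L (IsCMField.complexConj L) (complexConj_imagUnit L) (imagUnit_ne_zero L) (imagUnit_mul_self L)
            v 2 (gramR_isSymm L e dV hdV dW hdW) (hermD_eq_map_gramD L e dV hdV dW hdW) (fun w : UnitaryGroup.PlacesOver L v => χ.localComponent w.1) s (G i v s)) ∧
        (∀ i, ∀ v ∈ T.erase v₀, ∀ s, IsSmooth (Fp L) L (IsCMField.complexConj L) v 2 (G i v s)) ∧
        (∀ i, ∀ v ∈ T.erase v₀, ∀ s s' : ℂ, ∀ k ∈ K₀ v, G i v s k = G i v s' k) ∧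
        ∀ s : ℂ, 1 < s.re → HT s h' = ∑ i, Aface i s * ∏ v ∈ T.erase v₀,
          ∫ y : ↥(unipDeltaLoc L e dV hdV dW hdW v), conj ((unipDeltaChar L e dV hdV dW hdW S
                (locToAdelic L e dV hdV dW hdW v (y : UnitaryGroup.localPi L (IsCMField.complexConj L) (2 + 2) (hermD L e dV hdV dW hdW) v)) : ℂ)) *
              G i v s (UnitaryGroup.evalPlace (Fp L) L (IsCMField.complexConj L) (2 + 2) (hermD L e dV hdV dW hdW) v (UnitaryGroup.finPart (Fp L) L (IsCMField.complexConj L) (2 + 2) (hermD L e dV hdV dW hdW) (weylDelta L e dV hdV dW hdW)) *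
                (y : UnitaryGroup.localPi L (IsCMField.complexConj L) (2 + 2) (hermD L e dV hdV dW hdW) v) * UnitaryGroup.evalPlace (Fp L) L (IsCMField.complexConj L) (2 + 2) (hermD L e dV hdV dW hdW) v (UnitaryGroup.finPart (Fp L) L (IsCMField.complexConj L) (2 + 2) (hermD L e dV hdV dW hdW) h')) ∂(νv v) := by
  classical
  haveI hq : Algebra.IsQuadraticExtension (Fp L) L := IsCMField.isQuadraticExtension L
  -- ★ (E10a): the everywhere-adapted standard datum `𝒦⁺ ⊇ 𝒦` still carrying `f`, with compact open Iwasawa `K₀ v`, `ι_v(K₀ v) ⊆ 𝒦⁺.K`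
  obtain ⟨𝒦', h𝒦', hle, hstd', hK₀⟩ := exists_isStd_adaptedEverywhere L e dV hdV hdV0 dW hdW hdW0 h𝒦 hstd hcont
  choose K₀ hK₀c hK₀o hIw hK₀K using hK₀
  -- ★ (E6′) at `𝒦⁺`
  obtain ⟨S₀, hS₀⟩ := exists_awayPurity_flat L e dV hdV hdV0 dW hdW hdW0 h𝒦' hstd' hcont s₀
  refine ⟨S₀, ?_⟩
  intro T hS₀T hv₀ bT u₀ t ht d hd hbT rT hpure νinf _ _ νv _ _ S h' HT hHT
  obtain ⟨-, -, m, b, A, hb, hfin, hAc, hAsieg, -, hslice⟩ := hS₀ T hS₀T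
  -- the local flat families `G i v s = H⁺_v^{2(s−s₀)} b_{i,v}`, the arch ones, and the coefficients `c i`
  obtain ⟨G, hG⟩ : ∃ G : Fin m → ∀ v : HeightOneSpectrum (𝓞 (Fp L)), ℂ → UnitaryGroup.localPi L (IsCMField.complexConj L) (2 + 2) (hermD L e dV hdV dW hdW) v → ℂ,
      G = fun i v s u => ((modDelta L e dV hdV dW hdW (𝒦'.pPart (locToAdelic L e dV hdV dW hdW v u)) : ℝ) : ℂ) ^ (2 * (s - s₀)) * b i v u := ⟨_, rfl⟩
  obtain ⟨Ainf, hAinf⟩ : ∃ Ainf : Fin m → ℂ → UnitaryGroup.arch (Fp L) L (IsCMField.complexConj L) (2 + 2) (hermD L e dV hdV dW hdW) → ℂ,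
      Ainf = fun i s x => ((modDelta L e dV hdV dW hdW (𝒦'.pPart (UnitaryGroup.archToAdelic (Fp L) L (IsCMField.complexConj L) (2 + 2) (hermD L e dV hdV dW hdW) x)) : ℝ) : ℂ) ^ (2 * (s - s₀)) * A i x := ⟨_, rfl⟩
  obtain ⟨c, hc⟩ : ∃ c : Fin m → ℂ → ℂ, c = fun i s => (((t : ℝ) : ℂ) ^ (2 * (s - s₀)) * d)⁻¹ *
      (((modDelta L e dV hdV dW hdW (𝒦'.pPart (locToAdelic L e dV hdV dW hdW v₀ u₀)) : ℝ) : ℂ) ^ (2 * (s - s₀)) * b i v₀ u₀) := ⟨_, rfl⟩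
  have hne : ∀ s : ℂ, ((t : ℝ) : ℂ) ^ (2 * (s - s₀)) * d ≠ 0 := fun s =>
    mul_ne_zero (fun h0 => (Complex.ofReal_ne_zero.2 ht.ne') ((Complex.cpow_eq_zero_iff _ _).1 h0).1) hd
  -- (3) PURITY OF THE REST: `rT_s = Σ_i c_i(s) · A∞_i(s) ⊗ ⊗_{w ≠ v₀} G_{i,w}(s)`
  have hrT : ∀ (s : ℂ) (zi : UnitaryGroup.arch (Fp L) L (IsCMField.complexConj L) (2 + 2) (hermD L e dV hdV dW hdW)) (z : Π w : {w : T // w ≠ ⟨v₀, hv₀⟩}, UnitaryGroup.localPi L (IsCMField.complexConj L) (2 + 2) (hermD L e dV hdV dW hdW) w.1.1),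
      rT s (zi, z) = ∑ i, (c i s * Ainf i s zi) * ∏ w : {w : T // w ≠ ⟨v₀, hv₀⟩}, G i w.1.1 s (z w) := by
    intro s zi z
    -- the extension of `z` by `u₀` at `v₀`
    let y : Π v : T, UnitaryGroup.localPi L (IsCMField.complexConj L) (2 + 2) (hermD L e dV hdV dW hdW) v.1 := fun v => if hv : v = ⟨v₀, hv₀⟩ then cast (by rw [hv]) u₀ else z ⟨v, hv⟩
    have hy₀ : y ⟨v₀, hv₀⟩ = u₀ := by
      show (if hv : (⟨v₀, hv₀⟩ : T) = ⟨v₀, hv₀⟩ then cast _ u₀ else _) = u₀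
      rw [dif_pos rfl, cast_eq]
    have hyw : ∀ w : {w : T // w ≠ ⟨v₀, hv₀⟩}, y w.1 = z w := fun w => by
      show (if hv : w.1 = ⟨v₀, hv₀⟩ then cast _ u₀ else z ⟨w.1, hv⟩) = z w
      rw [dif_neg w.2]
    have h1 := hpure s zi y
    rw [hy₀, hbT s, show (fun w : {w : T // w ≠ ⟨v₀, hv₀⟩} => y w.1) = z from funext hyw] at h1
    have h2 := hslice s zi y
    have h3 : ∀ i : Fin m,
        ((modDelta L e dV hdV dW hdW (𝒦'.pPart (UnitaryGroup.archToAdelic (Fp L) L (IsCMField.complexConj L) (2 + 2) (hermD L e dV hdV dW hdW) zi)) : ℝ) : ℂ) ^ (2 * (s - s₀)) * A i zi *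
            ∏ v : T, (((modDelta L e dV hdV dW hdW (𝒦'.pPart (locToAdelic L e dV hdV dW hdW v.1 (y v))) : ℝ) : ℂ) ^ (2 * (s - s₀)) * b i v.1 (y v)) =
          (((modDelta L e dV hdV dW hdW (𝒦'.pPart (locToAdelic L e dV hdV dW hdW v₀ u₀)) : ℝ) : ℂ) ^ (2 * (s - s₀)) * b i v₀ u₀) *
            (Ainf i s zi * ∏ w : {w : T // w ≠ ⟨v₀, hv₀⟩}, G i w.1.1 s (z w)) := by
      intro i
      rw [Fintype.prod_eq_mul_prod_subtype_ne (fun v : T => ((modDelta L e dV hdV dW hdW (𝒦'.pPart (locToAdelic L e dV hdV dW hdW v.1 (y v))) : ℝ) : ℂ) ^ (2 * (s - s₀)) * b i v.1 (y v)) ⟨v₀, hv₀⟩, hy₀]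
      have hprod : ∏ w : {w : T // w ≠ ⟨v₀, hv₀⟩}, ((modDelta L e dV hdV dW hdW (𝒦'.pPart (locToAdelic L e dV hdV dW hdW w.1.1 (y w.1))) : ℝ) : ℂ) ^ (2 * (s - s₀)) * b i w.1.1 (y w.1) =
          ∏ w : {w : T // w ≠ ⟨v₀, hv₀⟩}, G i w.1.1 s (z w) := Finset.prod_congr rfl fun w _ => by rw [hyw w, hG]
      rw [hprod, hAinf]
      show _ * (((modDelta L e dV hdV dW hdW (𝒦'.pPart (locToAdelic L e dV hdV dW hdW v₀ u₀)) : ℝ) : ℂ) ^ (2 * (s - s₀)) * b i v₀ u₀ * _) = _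
      ring
    calc rT s (zi, z) = (((t : ℝ) : ℂ) ^ (2 * (s - s₀)) * d)⁻¹ * ((((t : ℝ) : ℂ) ^ (2 * (s - s₀)) * d) * rT s (zi, z)) := by
          rw [inv_mul_cancel_left₀ (hne s)]
      _ = (((t : ℝ) : ℂ) ^ (2 * (s - s₀)) * d)⁻¹ * stdExtension 𝒦 s₀ φ s (placesEmbed L (hermD L e dV hdV dW hdW) T (zi, y)) := by rw [h1]
      _ = ∑ i, (c i s * Ainf i s zi) * ∏ w : {w : T // w ≠ ⟨v₀, hv₀⟩}, G i w.1.1 s (z w) := by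
          rw [h2, Finset.mul_sum]
          refine Finset.sum_congr rfl fun i _ => ?_
          rw [h3 i, hc]
          ring
  -- the translated arguments and the two integrand families
  obtain ⟨X, hX⟩ : ∃ X : ↥(unipDeltaArch L e dV hdV dW hdW) → UnitaryGroup.arch (Fp L) L (IsCMField.complexConj L) (2 + 2) (hermD L e dV hdV dW hdW),
      X = fun p : ↥(unipDeltaArch L e dV hdV dW hdW) => UnitaryGroup.archPart (Fp L) L (IsCMField.complexConj L) (2 + 2) (hermD L e dV hdV dW hdW) (weylDelta L e dV hdV dW hdW) * (p : UnitaryGroup.arch (Fp L) L (IsCMField.complexConj L) (2 + 2) (hermD L e dV hdV dW hdW)) * UnitaryGroup.archPart (Fp L) L (IsCMField.complexConj L) (2 + 2) (hermD L e dV hdV dW hdW) h' := ⟨_, rfl⟩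
  obtain ⟨Y, hY⟩ : ∃ Y : ∀ w : {w : T // w ≠ ⟨v₀, hv₀⟩}, ↥(unipDeltaLoc L e dV hdV dW hdW w.1.1) → UnitaryGroup.localPi L (IsCMField.complexConj L) (2 + 2) (hermD L e dV hdV dW hdW) w.1.1,
      Y = fun w y => UnitaryGroup.evalPlace (Fp L) L (IsCMField.complexConj L) (2 + 2) (hermD L e dV hdV dW hdW) w.1.1 (UnitaryGroup.finPart (Fp L) L (IsCMField.complexConj L) (2 + 2) (hermD L e dV hdV dW hdW) (weylDelta L e dV hdV dW hdW)) * (y : UnitaryGroup.localPi L (IsCMField.complexConj L) (2 + 2) (hermD L e dV hdV dW hdW) w.1.1) * UnitaryGroup.evalPlace (Fp L) L (IsCMField.complexConj L) (2 + 2) (hermD L e dV hdV dW hdW) w.1.1 (UnitaryGroup.finPart (Fp L) L (IsCMField.complexConj L) (2 + 2) (hermD L e dV hdV dW hdW) h') := ⟨_, rfl⟩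
  obtain ⟨ψA, hψA⟩ : ∃ ψA : ↥(unipDeltaArch L e dV hdV dW hdW) → ℂ,
      ψA = fun p : ↥(unipDeltaArch L e dV hdV dW hdW) => (conj (unipDeltaChar L e dV hdV dW hdW S (UnitaryGroup.archToAdelic (Fp L) L (IsCMField.complexConj L) (2 + 2) (hermD L e dV hdV dW hdW) (p : UnitaryGroup.arch (Fp L) L (IsCMField.complexConj L) (2 + 2) (hermD L e dV hdV dW hdW))) : ℂ) : ℂ) := ⟨_, rfl⟩
  obtain ⟨ψv, hψv⟩ : ∃ ψv : ∀ w : {w : T // w ≠ ⟨v₀, hv₀⟩}, ↥(unipDeltaLoc L e dV hdV dW hdW w.1.1) → ℂ,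
      ψv = fun w y => (conj (unipDeltaChar L e dV hdV dW hdW S (locToAdelic L e dV hdV dW hdW w.1.1 (y : UnitaryGroup.localPi L (IsCMField.complexConj L) (2 + 2) (hermD L e dV hdV dW hdW) w.1.1))) : ℂ) := ⟨_, rfl⟩
  have hψAc : Continuous ψA := by
    rw [hψA]
    exact Complex.continuous_conj.comp ((continuous_unipDeltaChar L e dV hdV dW hdW S).comp
      ((UnitaryGroup.continuous_archToAdelic (Fp L) L (IsCMField.complexConj L) (2 + 2) (hermD L e dV hdV dW hdW)).comp continuous_subtype_val))
  have hψA1 : ∀ p, ‖ψA p‖ ≤ 1 := fun p => by rw [hψA, Complex.norm_conj, Circle.norm_coe]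
  have hψvc : ∀ w, Continuous (ψv w) := fun w => by
    rw [hψv]
    have hloc : Continuous (locToAdelic L e dV hdV dW hdW w.1.1) :=
      UnitaryGroup.continuous_inclPlaceAdelic (Fp L) L (IsCMField.complexConj L) (2 + 2) (hermD L e dV hdV dW hdW) w.1.1
    exact Complex.continuous_conj.comp ((continuous_unipDeltaChar L e dV hdV dW hdW S).comp (hloc.comp continuous_subtype_val))
  have hψv1 : ∀ w y, ‖ψv w y‖ ≤ 1 := fun w y => by rw [hψv, Complex.norm_conj, Circle.norm_coe]
  -- the arch faces
  obtain ⟨Aface, hAface⟩ : ∃ Aface : Fin m → ℂ → ℂ, Aface = fun i s => c i s * ∫ p : ↥(unipDeltaArch L e dV hdV dW hdW), ψA p * Ainf i s (X p) ∂νinf := ⟨_, rfl⟩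
  refine ⟨m, Aface, K₀, G, ⟨𝒦', c, A, h𝒦', hle, fun i => ?_, hAsieg, hfin, hAc, fun i s => ?_⟩, fun v _ => ⟨hK₀c v, hK₀o v⟩,
    fun v _ => hIw_local L e dV hdV dW hdW v (hIw v), fun i v hv s => ?_, fun i v hv s => ?_, fun i v _ s s' k hk => ?_, fun s hs => ?_⟩
  · -- `c i` is entire
    rw [hc]
    exact ((differentiable_heightTwist ht s₀ d).inv hne).mul
      (differentiable_heightTwist (modDelta_pos L e dV hdV dW hdW _) s₀ (b i v₀ u₀))
  · -- the arch face READ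
    rw [hAface, hψA, hAinf, hX]
  · -- Siegel law of `G i v s`
    rw [hG]
    exact heightTwistLoc_siegel L e dV hdV hdV0 dW hdW hdW0 v 𝒦' (hb i v (Finset.mem_of_mem_erase hv)) s
  · -- smoothness of `G i v s`
    rw [hG]
    exact heightTwistLoc_smooth L e dV hdV hdV0 dW hdW hdW0 v h𝒦' (hb i v (Finset.mem_of_mem_erase hv)).2 _
  · -- flatness on `K₀ v`
    rw [hG]
    exact heightTwistLoc_flat L e dV hdV hdV0 dW hdW hdW0 v 𝒦' (hK₀K v) s₀ (b i v) s s' k hk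
  · -- THE SPLIT at `s`, `1 < re s`: ★ p862082 Fubini over `ν_∞ ⊗ ⊗_{w ≠ v₀} ν_w` with ★ (E9) and `hAint`
    have hFint : ∀ i ∈ (Finset.univ : Finset (Fin m)), Integrable (fun p : ↥(unipDeltaArch L e dV hdV dW hdW) => c i s * (ψA p * Ainf i s (X p))) νinf := by
      intro i _
      have hbase : Integrable (fun p : ↥(unipDeltaArch L e dV hdV dW hdW) => Ainf i s (X p)) νinf := by
        rw [hAinf, hX]
        exact hAint 𝒦' h𝒦' (A i) (hAsieg i) (hfin i) (hAc i) νinf (UnitaryGroup.archPart (Fp L) L (IsCMField.complexConj L) (2 + 2) (hermD L e dV hdV dW hdW) h') s hs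
      exact (hbase.bdd_mul hψAc.aestronglyMeasurable (Filter.Eventually.of_forall hψA1)).const_mul (c i s)
    have hGint : ∀ i ∈ (Finset.univ : Finset (Fin m)), ∀ w : {w : T // w ≠ ⟨v₀, hv₀⟩},
        Integrable (fun y : ↥(unipDeltaLoc L e dV hdV dW hdW w.1.1) => ψv w y * G i w.1.1 s (Y w y)) (νv w.1.1) := by
      intro i _ w
      have hbase : Integrable (fun y : ↥(unipDeltaLoc L e dV hdV dW hdW w.1.1) => G i w.1.1 s (Y w y)) (νv w.1.1) := by
        rw [hG, hY]
        exact integrable_weylDelta_mul_unipDeltaLoc_cm L e dV hdV hdV0 dW hdW hdW0 w.1.1 (νv w.1.1) (hχ1 w.1.1) hs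
          (heightTwistLoc_siegel L e dV hdV hdV0 dW hdW hdW0 w.1.1 𝒦' (hb i w.1.1 w.1.2) s)
          (heightTwistLoc_smooth L e dV hdV hdV0 dW hdW hdW0 w.1.1 h𝒦' (hb i w.1.1 w.1.2).2 _) _
      exact hbase.bdd_mul (hψvc w).aestronglyMeasurable (Filter.Eventually.of_forall (hψv1 w))
    have key := integral_eq_sum_of_pureTensor νinf (fun w : {w : T // w ≠ ⟨v₀, hv₀⟩} => νv w.1.1) (Finset.univ : Finset (Fin m))
      (fun i p => c i s * (ψA p * Ainf i s (X p))) (fun i w y => ψv w y * G i w.1.1 s (Y w y)) hFint hGint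
      (fun p => (ψA p.1 * ∏ w : {w : T // w ≠ ⟨v₀, hv₀⟩}, ψv w (p.2 w)) * rT s (X p.1, fun w => Y w (p.2 w)))
      (fun p => by
        rw [hrT s, Finset.mul_sum]
        refine Finset.sum_congr rfl fun i _ => ?_
        rw [Finset.prod_mul_distrib]
        ring)
    have hHT' : HT s h' = ∫ p, (ψA p.1 * ∏ w : {w : T // w ≠ ⟨v₀, hv₀⟩}, ψv w (p.2 w)) * rT s (X p.1, fun w => Y w (p.2 w))
        ∂(νinf.prod (Measure.pi fun w : {w : T // w ≠ ⟨v₀, hv₀⟩} => νv w.1.1)) := by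
      rw [hHT s h', hψA, hψv, hX, hY]
    rw [hHT', key]
    refine Finset.sum_congr rfl fun i _ => ?_
    rw [integral_const_mul, hAface]
    congr 1
    refine prod_subtype_ne_eq_prod_erase T hv₀ _ _ (fun w => ?_)
    rw [hψv, hY]

end Summit.HodgeConjecture.HodgeConjecture.Cruxes.HLiu418.K2LiuLocalKernelHeadSplitAtKernelPlace

end
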